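import Summits.ResolutionOfSingularities.ResolutionOfSingularities.Theorems.WeightedInvariantWeightedChartSmoothPullback
import Literature.AlgebraicGeometry.Resolution.CotangentFlatAscent
import HarnessLib

/-!
# (P-a)′ Smooth pull-back of a weighted chart — base-field-free form

Route `ResolutionOfSingularities/WeightedInvariant`, door `Theses.WeightedInvariant.HypersurfaceCentreConstruction`
(stmt-ResolutionOfSingularities-19897), e-ladder `e = 1`, piece (P-a) (res-D-pv-025 AS res-L1-w43-stub-10). [OURS · L1 W4.3]
Sequel of `Theorems/WeightedInvariantWeightedChartSmoothPullback.lean` (p507858/p508371), asked for by res-D-pv-036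
(2026-08-27T07:44:36Z «YES PLEASE»): the same statements WITHOUT the perfect ground field `k` and without `f : Y ⟶ Spec k` —
`Y` only locally Noetherian, `g : Y₁ ⟶ Y` smooth — now that the residue-field-free cotangent ascent
`Literature.AlgebraicGeometry.Resolution.linearIndependent_toCotangent_stalkMap_of_smooth'` (res-D-pv-036, p510877,
`Literature/…/CotangentFlatAscent.lean`, Matsumura Thm. 23.7 (ii)) is in the tree: cotangent independence ascends along a smooth
morphism at EVERY point, so no closed-point / Jacobson / spreading detour is needed.

* `ReesAlgebraData.IsWeightedChart.of_comap_of_smooth'` — `(U, u, w)` a weighted chart of `R` on `Y`, `R₁.piece n = (R.piece n).comap g`,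
  `U₁ ⊆ g⁻¹U` affine ⇒ `(U₁, g^*u, w)` a weighted chart of `R₁` (any universe, any locally Noetherian `Y`);
* `ReesAlgebraData.IsRegularWeightedCentre.of_comap_of_smooth'` — regular weighted centres pull back along smooth morphisms.

Def-free helper, `--supports stmt-ResolutionOfSingularities-19897 --as helper`; nothing here is a claim about Hironaka's problem;
AI-written, weaker than expert review.
-/

noncomputable section

set_option linter.dupNamespace false -- mandated namespace of this single-conjunct summit

open CategoryTheory CategoryTheory.Limits AlgebraicGeometry TopologicalSpace IsLocalRing
open Literature.AlgebraicGeometry.Resolution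

namespace Summit.ResolutionOfSingularities.ResolutionOfSingularities.Theorems

universe u

/-- Germs of pulled-back sections are the images of the germs under the stalk map (universe-polymorphic form of
`germ_appLE_eq_stalkMap_germ`). [folklore] -/
theorem germ_appLE_eq_stalkMap_germ' {Y Y₁ : Scheme.{u}} (g : Y₁ ⟶ Y) (U : Y.affineOpens) (U₁ : Y₁.affineOpens)
    (hU₁ : (U₁ : Y₁.Opens) ≤ g ⁻¹ᵁ (U : Y.Opens)) {y₁ : Y₁} (hy₁ : y₁ ∈ (U₁ : Y₁.Opens)) (s : Γ(Y, U)) :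
    (Y₁.presheaf.germ (U₁ : Y₁.Opens) y₁ hy₁).hom ((g.appLE U U₁ hU₁).hom s) =
      (g.stalkMap y₁).hom ((Y.presheaf.germ (U : Y.Opens) (g y₁) (hU₁ hy₁)).hom s) := by
  have heq : g.appLE U U₁ hU₁ ≫ Y₁.presheaf.germ (U₁ : Y₁.Opens) y₁ hy₁ =
      Y.presheaf.germ (U : Y.Opens) (g y₁) (hU₁ hy₁) ≫ g.stalkMap y₁ := by
    rw [Scheme.Hom.germ_stalkMap, Scheme.Hom.appLE, Category.assoc, TopCat.Presheaf.germ_res]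
  have := congrArg (fun φ => φ.hom s) heq
  simpa only [CommRingCat.hom_comp, RingHom.comp_apply] using this

/-- **(P-a)′ Smooth pull-back of a weighted chart, base-field-free.** `Y` locally Noetherian, `g : Y₁ → Y` smooth; `R₁` the
pull-back of the Rees algebra `R` (`R₁.piece n = (R.piece n).comap g`); `(U, u, w)` a weighted chart of `R`; `U₁ ⊆ g⁻¹U` affine.
Then `(U₁, g^*u, w)` is a weighted chart of `R₁` — the cotangent independence at every point of `V(g^*u) ∩ U₁` ascends from the
chart at the image point by Matsumura 23.7 (ii) (`linearIndependent_toCotangent_stalkMap_of_smooth'`, p510877).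
[cite: Wlodarczyk2022, 2.1.10 and Lemma 2.1.12] [cite: Matsumura1987, Thm. 23.7] -/
theorem ReesAlgebraData.IsWeightedChart.of_comap_of_smooth' {Y Y₁ : Scheme.{u}} [IsLocallyNoetherian Y]
    (g : Y₁ ⟶ Y) [Smooth g] {R : ReesAlgebraData Y} {R₁ : ReesAlgebraData Y₁}
    (hR₁ : ∀ n, R₁.piece n = (R.piece n).comap g) {U : Y.affineOpens} {m : ℕ} {u : Fin m → Γ(Y, U)} {w : Fin m → ℕ}
    (h : R.IsWeightedChart U u w) (U₁ : Y₁.affineOpens) (hU₁ : (U₁ : Y₁.Opens) ≤ g ⁻¹ᵁ (U : Y.Opens)) :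
    R₁.IsWeightedChart U₁ (fun i => (g.appLE U U₁ hU₁).hom (u i)) w := by
  refine ⟨h.w_pos, fun n => ?_, fun y₁ hy₁ hvan => ?_⟩
  · rw [hR₁ n, ideal_comap_of_le g (R.piece n) U U₁ hU₁, h.ideal_eq n, weightedMonomialIdeal_map]
  · -- the parameters `u` vanish at `g y₁`
    have hmax : ∀ i, (Y.presheaf.germ (U : Y.Opens) (g y₁) (hU₁ hy₁)).hom (u i) ∈
        maximalIdeal (Y.presheaf.stalk (g y₁)) := by
      intro i
      have hi := hvan i
      rw [germ_appLE_eq_stalkMap_germ' g U U₁ hU₁ hy₁] at hi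
      rw [IsLocalRing.mem_maximalIdeal, mem_nonunits_iff] at hi ⊢
      exact fun hu => hi (hu.map _)
    -- independence at `g y₁` ascends along the smooth `g` (no residue-field hypothesis)
    have hli := linearIndependent_toCotangent_stalkMap_of_smooth' g y₁
      (fun i => (Y.presheaf.germ (U : Y.Opens) (g y₁) (hU₁ hy₁)).hom (u i)) hmax (h.linearIndependent (g y₁) (hU₁ hy₁) hmax)
    have hfam : (fun i => (maximalIdeal (Y₁.presheaf.stalk y₁)).toCotangent
        ⟨(g.stalkMap y₁).hom ((Y.presheaf.germ (U : Y.Opens) (g y₁) (hU₁ hy₁)).hom (u i)),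
          map_nonunit (g.stalkMap y₁).hom _ (hmax i)⟩) =
        fun i => (maximalIdeal (Y₁.presheaf.stalk y₁)).toCotangent
          ⟨(Y₁.presheaf.germ (U₁ : Y₁.Opens) y₁ hy₁).hom ((g.appLE U U₁ hU₁).hom (u i)), hvan i⟩ := by
      funext i
      congr 1
      exact Subtype.ext (germ_appLE_eq_stalkMap_germ' g U U₁ hU₁ hy₁ (u i)).symm
    rw [hfam] at hli
    exact hli

/-- **Regular weighted centres pull back along smooth morphisms (base-field-free).** [cite: Wlodarczyk2022, 2.1.10] -/
theorem ReesAlgebraData.IsRegularWeightedCentre.of_comap_of_smooth' {Y Y₁ : Scheme.{u}} [IsLocallyNoetherian Y]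
    (g : Y₁ ⟶ Y) [Smooth g] {R : ReesAlgebraData Y} {R₁ : ReesAlgebraData Y₁}
    (hR₁ : ∀ n, R₁.piece n = (R.piece n).comap g) (h : R.IsRegularWeightedCentre) : R₁.IsRegularWeightedCentre := by
  intro y₁
  obtain ⟨U, hyU, m, u, w, hchart⟩ := h (g y₁)
  obtain ⟨_, ⟨U₁, hU₁, rfl⟩, hy₁, hU₁le⟩ := Y₁.isBasis_affineOpens.exists_subset_of_mem_open
    (show y₁ ∈ ((g ⁻¹ᵁ (U : Y.Opens) : Y₁.Opens) : Set Y₁) from hyU) (g ⁻¹ᵁ (U : Y.Opens)).isOpen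
  exact ⟨⟨U₁, hU₁⟩, hy₁, m, _, w,
    ReesAlgebraData.IsWeightedChart.of_comap_of_smooth' g hR₁ hchart ⟨U₁, hU₁⟩ hU₁le⟩

end Summit.ResolutionOfSingularities.ResolutionOfSingularities.Theorems

end
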